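/-
Origin: expansion seat `planner-pub-hodgecm-pv05-g7-0`, handover #8 2026-08-18T15:02:21Z (`HOME/pub-hodgecm-pv05-g7/lean/Pv05g7/FockStoneGenerator.lean`, md5 c6f6d528, 378 lines);
landed by the gen-8 packager in gate run 31 as `HodgeCM/PerL34/FockStoneGenerator.lean` (import ^import Pv05g7\.FockCompactDiagonal[ \t]*$→import HodgeCM.PerL34.FockCompactDiagonal ×1; import ^import Pv05g7\.FockCoreDynamics[ \t]*$→import HodgeCM.PerL34.FockCoreDynamics ×1).
-/
/-
Origin: expansion seat `planner-pub-hodgecm-pv05-g7-0` (unit pub-hodgecm-pv05-g7, DAG-NODE PROVER #05 gen 7), leaf #8.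
Handover imports: `Pv05g7.FockCompactDiagonal` ↦ `HodgeCM.PerL34.FockCompactDiagonal` (pv05-g7 #7) and
`Pv05g7.FockCoreDynamics` ↦ `HodgeCM.PerL34.FockCoreDynamics` (pv05-g7 #6); the three Mathlib imports stay.

# The Stone generator of `t ↦ ν₀(e^{tX})` on the genuine Fock space, `X ∈ 𝔲(σ)`

KERNEL, additive leaf of the pv05 Fock lane (namespace `HodgeCM.PerL34.Fock.Hermite`).  Mathlib + lane only; no
citation is used as a hypothesis; hypotheses are `[Fintype σ] [DecidableEq σ]` and the displayed `star X = -X`.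

Leaves #1–#7 describe `ν₀(e^{tX})` and `dΓ(X)` on the polynomial CORE.  This file leaves the core: it identifies the
generator of the strongly continuous unitary group `t ↦ ν₀(e^{tX})` on ALL of `𝓕_σ ⊂ L²(ℂ^σ)` (Stone's theorem made
concrete by the spectral basis of #7, in which `ν₀(e^{tX})` is multiplication by `e^{it⟨m,λ⟩}`).

1. (§1) `t ↦ ν₀(e^{tX}) v` is continuous for EVERY `v ∈ 𝓕_σ` (`continuous_fockRep_expUnitary_apply`; density of the
   core + isometry).
2. (§2) Parseval in the spectral basis (`hasSum_norm_sq_specBasis_repr`).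
3. (§3) the STONE DOMAIN `genDom hX` = `{v : Σ_m ⟨m,λ⟩²|v_m|² < ∞}` (a `ℂ`-submodule; `mem_genDom_iff_summable`) and
   the generator `genOp hX : genDom hX →ₗ[ℂ] 𝓕_σ`, `(genOp v)_m = i⟨m,λ⟩ v_m` (`specBasis_repr_genOp`).
4. (§4) **differentiability ⇔ finite energy**: for `v ∈ genDom`, `d/dt|₀ ν₀(e^{tX})v = genOp v`
   (`hasDerivAt_fockRep_expUnitary_genOp`, dominated convergence in `ℓ²`); conversely, if `t ↦ ν₀(e^{tX})v` is
   differentiable at `0` with derivative `u` then `v ∈ genDom` and `u = genOp v` (`mem_genDom_of_hasDerivAt`,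
   `genOp_eq_of_hasDerivAt`); hence `genDom = {v : the orbit is differentiable at 0}` (`mem_genDom_iff_differentiableAt`).
5. (§5) the core lies in the domain and `genOp = dΓ(X)` there (`fockToL2_mem_genDom`, `genOp_fockToL2`): the Stone
   generator is an extension of `dΓ(X)|_{core}`; `genOp` is skew-symmetric on its domain
   (`inner_genOp_add_inner_genOp`); the domain is `ν₀(e^{tX})`-invariant, the orbit of a domain vector is
   differentiable at every time with `d/dt ν₀(e^{tX})v = ν₀(e^{tX})(genOp v)` (`hasDerivAt_fockRep_expUnitary_genOp_at`).

HONEST LABEL.  Compact directions `X ∈ 𝔲(σ)` only; "Stone generator" here means the derivative-at-zero operator on its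
maximal domain, identified coordinatewise; no statement about (essential) skew-adjointness as an unbounded-operator
notion of Mathlib (there is none), nor about the non-compact/metaplectic directions.
-/
import Mathlib.Analysis.Normed.Group.Tannery
import Mathlib.Analysis.SpecialFunctions.Trigonometric.Bounds
import Mathlib.Topology.UniformSpace.UniformApproximation
import Summits.HodgeConjecture.HodgeCM.PerL34.FockCompactDiagonal
import Summits.HodgeConjecture.HodgeCM.PerL34.FockCoreDynamics

noncomputable section

namespace HodgeCM.PerL34.Fock.Hermite

open Complex MvPolynomial Matrix NormedSpace Filter Topology
open scoped Real Nat ComplexConjugate InnerProductSpace ENNReal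

/- All inner products below are the Hilbert-space ones of `FockL2 σ` (see the note in `FockLadderAdjoint`). -/
attribute [local instance 10000] InnerProductSpace.toInner

variable {σ : Type*} [Fintype σ] [DecidableEq σ]

/-! ## §1  Strong continuity of `t ↦ ν₀(e^{tX})` on all of `𝓕_σ` -/

/-- (Ported verbatim from the HodgeCMPerL package; no docstring in the source.) -/
theorem continuous_fockRep_expUnitary_fockToL2 {X : Matrix σ σ ℂ} (hX : star X = -X) (F : MvPolynomial σ ℂ) :
    Continuous fun t : ℝ => fockRep (expUnitary X hX t) (fockToL2 F) :=
  continuous_iff_continuousAt.mpr fun t => (hasDerivAt_fockRep_expUnitary hX t F).continuousAt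

/-- **Strong continuity.**  For every `v ∈ 𝓕_σ` the orbit `t ↦ ν₀(e^{tX}) v` is continuous (`ε/3`: the core is dense
and every `ν₀(e^{tX})` is an isometry). -/
theorem continuous_fockRep_expUnitary_apply {X : Matrix σ σ ℂ} (hX : star X = -X) (v : FockL2 σ) :
    Continuous fun t : ℝ => fockRep (expUnitary X hX t) v := by
  refine continuous_of_uniform_approx_of_continuous fun u hu => ?_
  obtain ⟨ε, hε, hεu⟩ := Metric.mem_uniformity_dist.mp hu
  obtain ⟨G, hG⟩ := (denseRange_fockToL2 (σ := σ)).exists_dist_lt v hε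
  refine ⟨fun t => fockRep (expUnitary X hX t) (fockToL2 G), continuous_fockRep_expUnitary_fockToL2 hX G,
    fun t => hεu ?_⟩
  rwa [dist_eq_norm, ← map_sub, LinearIsometryEquiv.norm_map, ← dist_eq_norm]

/-- The group is jointly continuous in `(t, v)`-sequential sense needed below: `ν₀(e^{tX}) v → v` as `t → 0`. -/
theorem tendsto_fockRep_expUnitary_zero {X : Matrix σ σ ℂ} (hX : star X = -X) (v : FockL2 σ) :
    Tendsto (fun t : ℝ => fockRep (expUnitary X hX t) v) (𝓝 0) (𝓝 v) := by
  have h := (continuous_fockRep_expUnitary_apply hX v).tendsto 0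
  rwa [expUnitary_zero, map_one, LinearIsometryEquiv.coe_one, id_eq] at h

/-! ## §2  Parseval in the spectral basis -/

/-- (Ported verbatim from the HodgeCMPerL package; no docstring in the source.) -/
theorem hasSum_norm_sq_specBasis_repr {X : Matrix σ σ ℂ} (hX : star X = -X) (x : FockL2 σ) :
    HasSum (fun m => ‖(specBasis hX).repr x m‖ ^ 2) (‖x‖ ^ 2) := by
  have h := lp.hasSum_norm (p := 2) (by norm_num) ((specBasis hX).repr x)
  rw [LinearIsometryEquiv.norm_map] at h
  have h2 : (2 : ℝ≥0∞).toReal = 2 := by norm_num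
  simp only [h2, Real.rpow_two] at h
  exact h

/-- (Ported verbatim from the HodgeCMPerL package; no docstring in the source.) -/
theorem norm_sq_eq_tsum_specBasis_repr {X : Matrix σ σ ℂ} (hX : star X = -X) (x : FockL2 σ) :
    ‖x‖ ^ 2 = ∑' m, ‖(specBasis hX).repr x m‖ ^ 2 :=
  (hasSum_norm_sq_specBasis_repr hX x).tsum_eq.symm

/-! ## §3  The Stone domain and the generator -/

/-- **The Stone domain** of `X ∈ 𝔲(σ)`: the vectors `v ∈ 𝓕_σ` whose spectral coefficients have finite energy,
`(i⟨m,λ⟩ v_m)_m ∈ ℓ²`, i.e. `Σ_m ⟨m,λ⟩² |v_m|² < ∞` (`mem_genDom_iff_summable`). -/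
def genDom {X : Matrix σ σ ℂ} (hX : star X = -X) : Submodule ℂ (FockL2 σ) where
  carrier := {v | Memℓp (fun m : σ →₀ ℕ => I * (wtPair m (specFreq hX) : ℂ) * (specBasis hX).repr v m) 2}
  zero_mem' := by
    change Memℓp _ 2
    simp only [map_zero, lp.coeFn_zero, Pi.zero_apply, mul_zero]
    exact zero_memℓp
  add_mem' {v w} hv hw := by
    change Memℓp _ 2
    have h : (fun m : σ →₀ ℕ => I * (wtPair m (specFreq hX) : ℂ) * (specBasis hX).repr (v + w) m)
        = (fun m => I * (wtPair m (specFreq hX) : ℂ) * (specBasis hX).repr v m)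
          + fun m => I * (wtPair m (specFreq hX) : ℂ) * (specBasis hX).repr w m := by
      funext m
      simp only [map_add, lp.coeFn_add, Pi.add_apply, mul_add]
    rw [h]
    exact hv.add hw
  smul_mem' c v hv := by
    change Memℓp _ 2
    have h : (fun m : σ →₀ ℕ => I * (wtPair m (specFreq hX) : ℂ) * (specBasis hX).repr (c • v) m)
        = c • fun m => I * (wtPair m (specFreq hX) : ℂ) * (specBasis hX).repr v m := by
      funext m
      simp only [LinearIsometryEquiv.map_smul, lp.coeFn_smul, Pi.smul_apply, smul_eq_mul]
      ring
    rw [h]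
    exact hv.const_smul c

/-- (Ported verbatim from the HodgeCMPerL package; no docstring in the source.) -/
theorem mem_genDom_iff {X : Matrix σ σ ℂ} (hX : star X = -X) (v : FockL2 σ) :
    v ∈ genDom hX ↔ Memℓp (fun m : σ →₀ ℕ => I * (wtPair m (specFreq hX) : ℂ) * (specBasis hX).repr v m) 2 :=
  Iff.rfl

omit [Fintype σ] [DecidableEq σ] in
/-- (Ported verbatim from the HodgeCMPerL package; no docstring in the source.) -/
private theorem norm_I_mul_ofReal_mul_sq (w : ℝ) (z : ℂ) : ‖I * (w : ℂ) * z‖ ^ 2 = w ^ 2 * ‖z‖ ^ 2 := by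
  rw [norm_mul, norm_mul, Complex.norm_I, one_mul, Complex.norm_real, Real.norm_eq_abs, mul_pow, sq_abs]

/-- **Finite energy.**  `v ∈ genDom hX ↔ Σ_m ⟨m,λ⟩² ‖v_m‖² < ∞`. -/
theorem mem_genDom_iff_summable {X : Matrix σ σ ℂ} (hX : star X = -X) (v : FockL2 σ) :
    v ∈ genDom hX ↔ Summable fun m : σ →₀ ℕ => wtPair m (specFreq hX) ^ 2 * ‖(specBasis hX).repr v m‖ ^ 2 := by
  rw [mem_genDom_iff, memℓp_gen_iff (by norm_num)]
  have h2 : (2 : ℝ≥0∞).toReal = 2 := by norm_num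
  simp only [h2, Real.rpow_two, norm_I_mul_ofReal_mul_sq]

/-- The spectral coefficients of the generator: `(i⟨m,λ⟩ v_m)_m ∈ ℓ²` for `v ∈ genDom`. -/
def genCoord {X : Matrix σ σ ℂ} (hX : star X = -X) (v : genDom hX) : lp (fun _ : σ →₀ ℕ => ℂ) 2 :=
  ⟨fun m => I * (wtPair m (specFreq hX) : ℂ) * (specBasis hX).repr (v : FockL2 σ) m, v.2⟩

/-- (Ported verbatim from the HodgeCMPerL package; no docstring in the source.) -/
theorem genCoord_apply {X : Matrix σ σ ℂ} (hX : star X = -X) (v : genDom hX) (m : σ →₀ ℕ) :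
    genCoord hX v m = I * (wtPair m (specFreq hX) : ℂ) * (specBasis hX).repr (v : FockL2 σ) m := rfl

/-- **The Stone generator** `genOp hX : genDom hX →ₗ[ℂ] 𝓕_σ`, defined through the spectral basis of #7 by
`(genOp v)_m = i⟨m,λ⟩ · v_m`. -/
def genOp {X : Matrix σ σ ℂ} (hX : star X = -X) : genDom hX →ₗ[ℂ] FockL2 σ where
  toFun v := (specBasis hX).repr.symm (genCoord hX v)
  map_add' v w := by
    rw [← map_add]
    congr 1
    refine lp.ext (funext fun m => ?_)
    simp only [genCoord_apply, lp.coeFn_add, Pi.add_apply, Submodule.coe_add, map_add, mul_add]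
  map_smul' c v := by
    rw [RingHom.id_apply, ← LinearIsometryEquiv.map_smul]
    congr 1
    refine lp.ext (funext fun m => ?_)
    simp only [genCoord_apply, lp.coeFn_smul, Pi.smul_apply, Submodule.coe_smul, LinearIsometryEquiv.map_smul,
      smul_eq_mul]
    ring

/-- (Ported verbatim from the HodgeCMPerL package; no docstring in the source.) -/
theorem genOp_apply {X : Matrix σ σ ℂ} (hX : star X = -X) (v : genDom hX) :
    genOp hX v = (specBasis hX).repr.symm (genCoord hX v) := rfl

/-- `(genOp v)_m = i⟨m,λ⟩ v_m`. -/
theorem specBasis_repr_genOp {X : Matrix σ σ ℂ} (hX : star X = -X) (v : genDom hX) (m : σ →₀ ℕ) :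
    (specBasis hX).repr (genOp hX v) m = I * (wtPair m (specFreq hX) : ℂ) * (specBasis hX).repr (v : FockL2 σ) m := by
  rw [genOp_apply, LinearIsometryEquiv.apply_symm_apply, genCoord_apply]

/-! ## §4  Differentiability of the orbit ⇔ finite energy -/

omit [Fintype σ] [DecidableEq σ] in
/-- `d/dt|₀ e^{itw} = iw`, as a limit of difference quotients. -/
private theorem tendsto_slope_cexp (w : ℝ) :
    Tendsto (fun t : ℝ => (t : ℂ)⁻¹ * (cexp (I * t * w) - 1) - I * w) (𝓝[≠] 0) (𝓝 0) := by
  have h1 : HasDerivAt (fun t : ℝ => I * (t : ℂ) * w) (I * 1 * w) 0 :=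
    (((hasDerivAt_id (0 : ℝ)).ofReal_comp).const_mul I).mul_const (w : ℂ)
  have h2 := h1.cexp
  simp only [mul_one, Complex.ofReal_zero, mul_zero, zero_mul, Complex.exp_zero, one_mul] at h2
  rw [hasDerivAt_iff_tendsto_slope_zero] at h2
  simp only [zero_add, Complex.ofReal_zero, mul_zero, zero_mul, Complex.exp_zero] at h2
  have h3 := h2.sub_const (I * (w : ℂ))
  rw [sub_self] at h3
  refine h3.congr fun t => ?_
  rw [Complex.real_smul, Complex.ofReal_inv]

omit [Fintype σ] [DecidableEq σ] in
/-- `|t⁻¹(e^{itw} − 1) − iw| ≤ 2|w|` for `t ≠ 0`. -/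
private theorem norm_slope_cexp_le (w : ℝ) {t : ℝ} (ht : t ≠ 0) :
    ‖(t : ℂ)⁻¹ * (cexp (I * t * w) - 1) - I * w‖ ≤ 2 * |w| := by
  have h1 : ‖(t : ℂ)⁻¹ * (cexp (I * t * w) - 1)‖ ≤ |w| := by
    rw [norm_mul, norm_inv, Complex.norm_real, Real.norm_eq_abs]
    have h := (Real.norm_exp_I_mul_ofReal_sub_one_le (x := t * w))
    rw [Complex.ofReal_mul, ← mul_assoc, Real.norm_eq_abs, abs_mul] at h
    calc |t|⁻¹ * ‖cexp (I * t * w) - 1‖ ≤ |t|⁻¹ * (|t| * |w|) := by gcongr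
      _ = |w| := by rw [← mul_assoc, inv_mul_cancel₀ (abs_ne_zero.mpr ht), one_mul]
  calc ‖(t : ℂ)⁻¹ * (cexp (I * t * w) - 1) - I * w‖
      ≤ ‖(t : ℂ)⁻¹ * (cexp (I * t * w) - 1)‖ + ‖I * (w : ℂ)‖ := norm_sub_le _ _
    _ ≤ |w| + |w| := by
        gcongr
        rw [norm_mul, Complex.norm_I, one_mul, Complex.norm_real, Real.norm_eq_abs]
    _ = 2 * |w| := by ring

/-- **Finite energy ⇒ differentiable, with derivative the generator.**  For `v ∈ genDom hX`,
`d/dt|₀ ν₀(e^{tX}) v = genOp v` in `𝓕_σ` (dominated convergence in `ℓ²`: the `m`-th coordinate of the difference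
quotient minus `genOp v` is `(t⁻¹(e^{it⟨m,λ⟩} − 1) − i⟨m,λ⟩) v_m`, bounded by `2|⟨m,λ⟩| |v_m|` and tending to `0`). -/
theorem hasDerivAt_fockRep_expUnitary_genOp {X : Matrix σ σ ℂ} (hX : star X = -X) (v : genDom hX) :
    HasDerivAt (fun t : ℝ => fockRep (expUnitary X hX t) (v : FockL2 σ)) (genOp hX v) 0 := by
  set w : (σ →₀ ℕ) → ℝ := fun m => wtPair m (specFreq hX) with hw
  set c : (σ →₀ ℕ) → ℂ := fun m => (specBasis hX).repr (v : FockL2 σ) m with hc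
  -- coordinates of the defect vector `D t = t⁻¹ (ν_t v − v) − genOp v`
  have hcoord : ∀ (t : ℝ) (m : σ →₀ ℕ),
      (specBasis hX).repr (((t : ℂ)⁻¹) • (fockRep (expUnitary X hX t) (v : FockL2 σ) - v) - genOp hX v) m
        = ((t : ℂ)⁻¹ * (cexp (I * t * w m) - 1) - I * w m) * c m := by
    intro t m
    simp only [map_sub, LinearIsometryEquiv.map_smul, lp.coeFn_sub, lp.coeFn_smul, Pi.sub_apply, Pi.smul_apply,
      smul_eq_mul, specBasis_repr_fockRep_expUnitary, specBasis_repr_genOp, hw, hc]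
    ring
  have hnorm : ∀ t : ℝ, ‖((t : ℂ)⁻¹) • (fockRep (expUnitary X hX t) (v : FockL2 σ) - v) - genOp hX v‖ ^ 2
      = ∑' m, ‖(t : ℂ)⁻¹ * (cexp (I * t * w m) - 1) - I * w m‖ ^ 2 * ‖c m‖ ^ 2 := by
    intro t
    rw [norm_sq_eq_tsum_specBasis_repr hX]
    exact tsum_congr fun m => by rw [hcoord, norm_mul, mul_pow]
  -- the summable dominating sequence `4⟨m,λ⟩² |v_m|²`
  have hsum : Summable fun m => (2 * |w m|) ^ 2 * ‖c m‖ ^ 2 := by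
    have h := (mem_genDom_iff_summable hX (v : FockL2 σ)).mp v.2
    refine (h.mul_left 4).congr fun m => ?_
    rw [mul_pow, sq_abs]
    ring
  -- dominated convergence
  have hT : Tendsto (fun t : ℝ => ∑' m, ‖(t : ℂ)⁻¹ * (cexp (I * t * w m) - 1) - I * w m‖ ^ 2 * ‖c m‖ ^ 2)
      (𝓝[≠] 0) (𝓝 (∑' _ : σ →₀ ℕ, (0 : ℝ))) := by
    refine tendsto_tsum_of_dominated_convergence hsum (fun m => ?_) ?_
    · have h := (((tendsto_slope_cexp (w m)).norm).pow 2).mul_const (‖c m‖ ^ 2)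
      rwa [norm_zero, zero_pow two_ne_zero, zero_mul] at h
    · refine eventually_nhdsWithin_of_forall fun t ht m => ?_
      rw [Real.norm_of_nonneg (by positivity)]
      exact mul_le_mul_of_nonneg_right (pow_le_pow_left₀ (norm_nonneg _) (norm_slope_cexp_le (w m) ht) 2)
        (sq_nonneg _)
  rw [tsum_zero] at hT
  have hD : Tendsto (fun t : ℝ => ‖((t : ℂ)⁻¹) • (fockRep (expUnitary X hX t) (v : FockL2 σ) - v) - genOp hX v‖)
      (𝓝[≠] 0) (𝓝 0) := by
    have h3 := hT.sqrt
    rw [Real.sqrt_zero] at h3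
    refine h3.congr fun t => ?_
    rw [← hnorm, Real.sqrt_sq (norm_nonneg _)]
  -- conclude (the real scalar `t⁻¹ •` of the slope is the complex scalar `(↑t)⁻¹ •`)
  have hsmul : ∀ (t : ℝ) (y : FockL2 σ), t⁻¹ • y = ((t : ℂ)⁻¹) • y := fun t y =>
    calc t⁻¹ • y = ((t⁻¹ : ℝ) : ℂ) • y := RCLike.real_smul_eq_coe_smul (K := ℂ) _ _
      _ = ((t : ℂ)⁻¹) • y := by rw [Complex.ofReal_inv]
  rw [hasDerivAt_iff_tendsto_slope_zero]
  refine tendsto_iff_norm_sub_tendsto_zero.mpr (hD.congr fun t => ?_)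
  rw [zero_add, expUnitary_zero, map_one, LinearIsometryEquiv.coe_one, id_eq, hsmul]

/-- **Differentiable ⇒ finite energy, and the derivative is the generator.**  If `t ↦ ν₀(e^{tX}) v` has a
derivative `u` at `t = 0`, then `v ∈ genDom hX` and `u_m = i⟨m,λ⟩ v_m` for every `m`. -/
theorem mem_genDom_of_hasDerivAt {X : Matrix σ σ ℂ} (hX : star X = -X) {v u : FockL2 σ}
    (h : HasDerivAt (fun t : ℝ => fockRep (expUnitary X hX t) v) u 0) :
    v ∈ genDom hX ∧ ∀ m, (specBasis hX).repr u m = I * (wtPair m (specFreq hX) : ℂ) * (specBasis hX).repr v m := by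
  have hc : ∀ m, (specBasis hX).repr u m = I * (wtPair m (specFreq hX) : ℂ) * (specBasis hX).repr v m := by
    intro m
    -- derivative of the `m`-th coordinate, computed two ways
    have h1 : HasDerivAt (fun t : ℝ => ⟪specBasis hX m, fockRep (expUnitary X hX t) v⟫_ℂ) ⟪specBasis hX m, u⟫_ℂ 0 := by
      have h' := (hasDerivAt_const (0 : ℝ) (specBasis hX m)).inner ℂ h
      simpa only [inner_zero_left, add_zero] using h'
    have h2 : HasDerivAt (fun t : ℝ => ⟪specBasis hX m, fockRep (expUnitary X hX t) v⟫_ℂ)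
        (I * (wtPair m (specFreq hX) : ℂ) * (specBasis hX).repr v m) 0 := by
      have hd : HasDerivAt (fun t : ℝ => I * (t : ℂ) * (wtPair m (specFreq hX) : ℂ))
          (I * 1 * (wtPair m (specFreq hX) : ℂ)) 0 :=
        (((hasDerivAt_id (0 : ℝ)).ofReal_comp).const_mul I).mul_const _
      have he := (hd.cexp).mul_const ((specBasis hX).repr v m)
      simp only [mul_one, Complex.ofReal_zero, mul_zero, zero_mul, Complex.exp_zero, one_mul] at he
      refine he.congr_of_eventuallyEq (Eventually.of_forall fun t => ?_)
      show ⟪specBasis hX m, fockRep (expUnitary X hX t) v⟫_ℂ = _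
      rw [← HilbertBasis.repr_apply_apply, specBasis_repr_fockRep_expUnitary]
    rw [HilbertBasis.repr_apply_apply]
    exact h1.unique h2
  refine ⟨?_, hc⟩
  have hfun : (fun m : σ →₀ ℕ => I * (wtPair m (specFreq hX) : ℂ) * (specBasis hX).repr v m)
      = ⇑((specBasis hX).repr u) := funext fun m => (hc m).symm
  change Memℓp _ 2
  rw [hfun]
  exact lp.memℓp _

/-- (Ported verbatim from the HodgeCMPerL package; no docstring in the source.) -/
theorem genOp_eq_of_hasDerivAt {X : Matrix σ σ ℂ} (hX : star X = -X) {v u : FockL2 σ}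
    (h : HasDerivAt (fun t : ℝ => fockRep (expUnitary X hX t) v) u 0) :
    genOp hX ⟨v, (mem_genDom_of_hasDerivAt hX h).1⟩ = u := by
  apply (specBasis hX).repr.injective
  refine lp.ext (funext fun m => ?_)
  rw [specBasis_repr_genOp, (mem_genDom_of_hasDerivAt hX h).2 m]

/-- **The Stone domain is exactly the set of differentiable vectors.** -/
theorem mem_genDom_iff_differentiableAt {X : Matrix σ σ ℂ} (hX : star X = -X) (v : FockL2 σ) :
    v ∈ genDom hX ↔ DifferentiableAt ℝ (fun t : ℝ => fockRep (expUnitary X hX t) v) 0 :=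
  ⟨fun hv => (hasDerivAt_fockRep_expUnitary_genOp hX ⟨v, hv⟩).differentiableAt,
    fun hd => (mem_genDom_of_hasDerivAt hX hd.hasDerivAt).1⟩

/-- (Ported verbatim from the HodgeCMPerL package; no docstring in the source.) -/
theorem deriv_fockRep_expUnitary_zero_of_mem {X : Matrix σ σ ℂ} (hX : star X = -X) (v : genDom hX) :
    deriv (fun t : ℝ => fockRep (expUnitary X hX t) (v : FockL2 σ)) 0 = genOp hX v :=
  (hasDerivAt_fockRep_expUnitary_genOp hX v).deriv

/-! ## §5  The generator extends `dΓ(X)|_{core}`, is skew-symmetric, and commutes with the group -/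

/-- The polynomial core lies in the Stone domain … -/
theorem fockToL2_mem_genDom {X : Matrix σ σ ℂ} (hX : star X = -X) (F : MvPolynomial σ ℂ) :
    fockToL2 F ∈ genDom hX :=
  (mem_genDom_of_hasDerivAt hX (hasDerivAt_fockRep_expUnitary_zero hX F)).1

/-- … and there **`genOp = dΓ(X)`**: the Stone generator extends the infinitesimal action on the core (#1, #4). -/
theorem genOp_fockToL2 {X : Matrix σ σ ℂ} (hX : star X = -X) (F : MvPolynomial σ ℂ) :
    genOp hX ⟨fockToL2 F, fockToL2_mem_genDom hX F⟩ = fockToL2 (dGamma X F) :=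
  genOp_eq_of_hasDerivAt hX (hasDerivAt_fockRep_expUnitary_zero hX F)

/-- **Skew-symmetry of the generator on its domain**: `⟪genOp v, w⟫ + ⟪v, genOp w⟫ = 0` for `v, w ∈ genDom`. -/
theorem inner_genOp_add_inner_genOp {X : Matrix σ σ ℂ} (hX : star X = -X) (v w : genDom hX) :
    ⟪genOp hX v, (w : FockL2 σ)⟫_ℂ + ⟪(v : FockL2 σ), genOp hX w⟫_ℂ = 0 := by
  have h := ((specBasis hX).hasSum_inner_mul_inner (genOp hX v) (w : FockL2 σ)).add
    ((specBasis hX).hasSum_inner_mul_inner (v : FockL2 σ) (genOp hX w))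
  have h0 : (fun m => ⟪genOp hX v, specBasis hX m⟫_ℂ * ⟪specBasis hX m, (w : FockL2 σ)⟫_ℂ
      + ⟪(v : FockL2 σ), specBasis hX m⟫_ℂ * ⟪specBasis hX m, genOp hX w⟫_ℂ) = fun _ => 0 := by
    funext m
    rw [← inner_conj_symm (genOp hX v) (specBasis hX m), ← inner_conj_symm (v : FockL2 σ) (specBasis hX m)]
    simp only [← HilbertBasis.repr_apply_apply, specBasis_repr_genOp, map_mul, Complex.conj_I, Complex.conj_ofReal]
    ring
  rw [h0] at h
  exact h.unique hasSum_zero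

/-- `Re ⟪genOp v, v⟫ = 0`: the energy form of the generator is purely imaginary. -/
theorem re_inner_genOp_self {X : Matrix σ σ ℂ} (hX : star X = -X) (v : genDom hX) :
    (⟪genOp hX v, (v : FockL2 σ)⟫_ℂ).re = 0 := by
  have h := congrArg Complex.re (inner_genOp_add_inner_genOp hX v v)
  rw [Complex.add_re, ← inner_conj_symm (v : FockL2 σ) (genOp hX v), Complex.conj_re, Complex.zero_re] at h
  linarith

omit [Fintype σ] [DecidableEq σ] in
/-- (Ported verbatim from the HodgeCMPerL package; no docstring in the source.) -/
private theorem norm_cexp_I_mul_mul (t w : ℝ) : ‖cexp (I * t * w)‖ = 1 := by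
  rw [show I * (t : ℂ) * w = ((t * w : ℝ) : ℂ) * I by push_cast; ring, Complex.norm_exp_ofReal_mul_I]

/-- The Stone domain is invariant under the group. -/
theorem fockRep_expUnitary_mem_genDom {X : Matrix σ σ ℂ} (hX : star X = -X) (v : genDom hX) (t : ℝ) :
    fockRep (expUnitary X hX t) (v : FockL2 σ) ∈ genDom hX := by
  rw [mem_genDom_iff_summable]
  refine ((mem_genDom_iff_summable hX (v : FockL2 σ)).mp v.2).congr fun m => ?_
  rw [specBasis_repr_fockRep_expUnitary, norm_mul, norm_cexp_I_mul_mul, one_mul]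

/-- **At every time**: for `v ∈ genDom`, `d/dt ν₀(e^{tX}) v = ν₀(e^{tX}) (genOp v)` (group law + §4). -/
theorem hasDerivAt_fockRep_expUnitary_genOp_at {X : Matrix σ σ ℂ} (hX : star X = -X) (v : genDom hX) (t₀ : ℝ) :
    HasDerivAt (fun t : ℝ => fockRep (expUnitary X hX t) (v : FockL2 σ))
      (fockRep (expUnitary X hX t₀) (genOp hX v)) t₀ := by
  have hfun : (fun t : ℝ => fockRep (expUnitary X hX t) (v : FockL2 σ))
      = fun t => fockRep (expUnitary X hX t₀) (fockRep (expUnitary X hX (t - t₀)) (v : FockL2 σ)) := by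
    funext t
    have ht : expUnitary X hX t = expUnitary X hX t₀ * expUnitary X hX (t - t₀) := by
      rw [← expUnitary_add, add_sub_cancel]
    rw [ht, map_mul, LinearIsometryEquiv.coe_mul, Function.comp_apply]
  have h0 := hasDerivAt_fockRep_expUnitary_genOp hX v
  rw [← sub_self t₀] at h0
  have hin : HasDerivAt (fun t : ℝ => fockRep (expUnitary X hX (t - t₀)) (v : FockL2 σ)) (genOp hX v) t₀ :=
    h0.comp_sub_const t₀ t₀
  let L : FockL2 σ →L[ℝ] FockL2 σ :=
    ((fockRep (expUnitary X hX t₀)).toContinuousLinearEquiv : FockL2 σ →L[ℂ] FockL2 σ).restrictScalars ℝ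
  rw [hfun]
  exact L.hasFDerivAt.comp_hasDerivAt t₀ hin

/-- **The generator commutes with the group**: `genOp (ν₀(e^{tX}) v) = ν₀(e^{tX}) (genOp v)` for `v ∈ genDom`. -/
theorem genOp_fockRep_expUnitary {X : Matrix σ σ ℂ} (hX : star X = -X) (v : genDom hX) (t₀ : ℝ) :
    genOp hX ⟨fockRep (expUnitary X hX t₀) (v : FockL2 σ), fockRep_expUnitary_mem_genDom hX v t₀⟩
      = fockRep (expUnitary X hX t₀) (genOp hX v) := by
  -- both sides are the derivative at `s = 0` of `s ↦ ν₀(e^{sX}) ν₀(e^{t₀X}) v = ν₀(e^{(s+t₀)X}) v`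
  have h1 := hasDerivAt_fockRep_expUnitary_genOp hX
    ⟨fockRep (expUnitary X hX t₀) (v : FockL2 σ), fockRep_expUnitary_mem_genDom hX v t₀⟩
  have h2 : HasDerivAt (fun s : ℝ => fockRep (expUnitary X hX s) (fockRep (expUnitary X hX t₀) (v : FockL2 σ)))
      (fockRep (expUnitary X hX t₀) (genOp hX v)) 0 := by
    have h := (hasDerivAt_fockRep_expUnitary_genOp_at hX v (0 + t₀)).comp_add_const 0 t₀
    rw [zero_add] at h
    refine h.congr_of_eventuallyEq (Eventually.of_forall fun s => ?_)
    show fockRep (expUnitary X hX s) (fockRep (expUnitary X hX t₀) (v : FockL2 σ))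
      = fockRep (expUnitary X hX (s + t₀)) (v : FockL2 σ)
    rw [expUnitary_add, map_mul, LinearIsometryEquiv.coe_mul, Function.comp_apply]
  exact h1.unique h2

end HodgeCM.PerL34.Fock.Hermite

end
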